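import Literature.MathematicalPhysics.QuantumLattice.HubbardNNNHoppingFlux
import Summits.Ventures.CertifiedManyBodySolver.Observables.ThermalFluxZeemanOperator
import Mathlib
import HarnessLib

/-!
# The fugacity-torus projection identity (Darwin–Fowler at complex temperature)

Helper module for route `TcThermcert1`, crux K1 `ThermalStiffnessCeilingU8b10_le_1o8` (item `stmt-Ventures-26381`), line
`Cruxes/ThermalStiffnessCeilingU8b10_le_1o8/Lines/zerofree_corridor.lean`, stub `stub_fugacityProjection` (K1 of the crux idea
`Ideas/fugacity-torus-saddle.md`): for a matrix `H` on the fermionic occupation basis that conserves `N↑` and `N↓`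
(`PreservesSectors H`) and a coordinate sector `p = {s : #↑s = a, #↓s = b}`, the complex-temperature sector partition function is the
`(a, b)` Fourier–Cauchy coefficient of the two-fugacity grand-canonical trace on any pair of circles `|ζ↑| = |ζ↓| = r > 0`:

  `tr e^{−β H_p} = (2π)⁻² ∫₀^{2π}∫₀^{2π} tr( diag(ζ↑^{N↑} ζ↓^{N↓}) e^{−βH} ) ζ↑^{−a} ζ↓^{−b} dψ dφ`,  `ζ↑ = re^{iφ}`, `ζ↓ = re^{iψ}`,

for every complex `β` (§3), together with the two elementary inputs: the circle moments `∫₀^{2π} z^k z^{−m} dφ = 2π·[k = m]` and the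
resulting coefficient extraction for finite sums (§1), and the compression of `e^{−βH}` to a sector of a sector-preserving `H` (§2).
§4 specialises to the seam-flux `t–t′` Hubbard torus `hubbardTorusTT'Flux L t′ U θ` (which conserves `N↑, N↓`) and to the sector
predicate of `thermalFluxLogZ` (`#s = 2m ∧ 2·#{spin-0 orbitals of s} = 2m`, i.e. `#↑ = #↓ = m`).

Everything here is finite-dimensional linear algebra plus `∫₀^{2π} e^{inφ} dφ = 2π·[n = 0]` (folklore; the classical Darwin–Fowler
contour representation of canonical partition functions, here at complex `β`). No physics claim is made — in particular nothing about
superconductivity in the Hubbard model is proved by anything in this file.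
-/

namespace Summit.Ventures.CertifiedManyBodySolver.Theorems.TcThermcert1.ZeroFreeCorridor

open Matrix Finset Complex MeasureTheory intervalIntegral
open Literature.MathematicalPhysics.QuantumLattice
open Summit.HubbardSuperconductivity.HubbardSuperconductivity.Theorems.WidthHaldane
open Summit.Ventures.CertifiedManyBodySolver.Observables

/-! ## §1 Circle moments and coefficient extraction for finite sums -/

section Circle

/-- A point of the circle of radius `r > 0` is non-zero. -/
theorem circlePoint_ne_zero {r : ℝ} (hr : 0 < r) (φ : ℝ) : (r : ℂ) * cexp ((φ : ℂ) * I) ≠ 0 :=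
  mul_ne_zero (ofReal_ne_zero.mpr hr.ne') (Complex.exp_ne_zero _)

/-- `φ ↦ z(φ)^k / z(φ)^m` is continuous on the circle `z(φ) = r e^{iφ}`, `r > 0`. -/
theorem continuous_circlePoint_pow_div {r : ℝ} (hr : 0 < r) (k m : ℕ) :
    Continuous fun φ : ℝ => ((r : ℂ) * cexp ((φ : ℂ) * I)) ^ k / ((r : ℂ) * cexp ((φ : ℂ) * I)) ^ m :=
  Continuous.div (by fun_prop) (by fun_prop) fun φ => pow_ne_zero _ (circlePoint_ne_zero hr φ)

/-- **Circle moments**: `∫₀^{2π} z^k / z^m dφ = 2π·[k = m]` on the circle `z = r e^{iφ}`, `r > 0`. -/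
theorem integral_circlePoint_pow_div {r : ℝ} (hr : 0 < r) (k m : ℕ) :
    ∫ φ in (0 : ℝ)..2 * Real.pi, ((r : ℂ) * cexp ((φ : ℂ) * I)) ^ k / ((r : ℂ) * cexp ((φ : ℂ) * I)) ^ m =
      if k = m then (2 * Real.pi : ℂ) else 0 := by
  by_cases hkm : k = m
  · subst hkm
    rw [if_pos rfl]
    have h1 : ∀ φ : ℝ, ((r : ℂ) * cexp ((φ : ℂ) * I)) ^ k / ((r : ℂ) * cexp ((φ : ℂ) * I)) ^ k = 1 :=
      fun φ => div_self (pow_ne_zero _ (circlePoint_ne_zero hr φ))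
    simp_rw [h1]
    rw [intervalIntegral.integral_const, sub_zero, Complex.real_smul, mul_one]
    push_cast
    rfl
  · rw [if_neg hkm]
    have hc : ((k : ℂ) - m) * I ≠ 0 :=
      mul_ne_zero (sub_ne_zero.mpr (by exact_mod_cast hkm)) I_ne_zero
    have hpt : ∀ φ : ℝ, ((r : ℂ) * cexp ((φ : ℂ) * I)) ^ k / ((r : ℂ) * cexp ((φ : ℂ) * I)) ^ m =
        (r : ℂ) ^ k / (r : ℂ) ^ m * cexp (((k : ℂ) - m) * I * φ) := by
      intro φ
      rw [mul_pow, mul_pow, ← Complex.exp_nat_mul, ← Complex.exp_nat_mul, mul_div_mul_comm, ← Complex.exp_sub]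
      congr 2
      ring
    simp_rw [hpt]
    rw [intervalIntegral.integral_const_mul, integral_exp_mul_complex hc]
    have h2 : cexp (((k : ℂ) - m) * I * ((2 * Real.pi : ℝ) : ℂ)) = 1 := by
      have := Complex.exp_int_mul_two_pi_mul_I ((k : ℤ) - m)
      rw [← this]
      congr 1
      push_cast
      ring
    rw [h2]
    simp

/-- **Coefficient extraction on the fugacity torus for a finite sum of monomials**: the `(a,b)`-coefficient integral of
`Σ_i c_i z^{k_i} w^{l_i}` over `|z| = |w| = r` is `Σ_{i : k_i = a, l_i = b} c_i`. -/
theorem torusIntegral_finset_sum {ι : Type*} (s : Finset ι) (c : ι → ℂ) (k l : ι → ℕ) {r : ℝ} (hr : 0 < r) (a b : ℕ) :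
    ((2 * Real.pi : ℂ) ^ 2)⁻¹ * ∫ φ in (0 : ℝ)..2 * Real.pi, ∫ ψ in (0 : ℝ)..2 * Real.pi,
      (∑ i ∈ s, c i * (((r : ℂ) * cexp ((φ : ℂ) * I)) ^ k i * ((r : ℂ) * cexp ((ψ : ℂ) * I)) ^ l i)) /
        (((r : ℂ) * cexp ((φ : ℂ) * I)) ^ a * ((r : ℂ) * cexp ((ψ : ℂ) * I)) ^ b) =
      ∑ i ∈ s, if k i = a ∧ l i = b then c i else 0 := by
  -- the inner integral, for fixed `φ`
  have hinner : ∀ φ : ℝ, ∫ ψ in (0 : ℝ)..2 * Real.pi,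
      (∑ i ∈ s, c i * (((r : ℂ) * cexp ((φ : ℂ) * I)) ^ k i * ((r : ℂ) * cexp ((ψ : ℂ) * I)) ^ l i)) /
        (((r : ℂ) * cexp ((φ : ℂ) * I)) ^ a * ((r : ℂ) * cexp ((ψ : ℂ) * I)) ^ b) =
      ∑ i ∈ s, (c i * (if l i = b then (2 * Real.pi : ℂ) else 0)) *
        (((r : ℂ) * cexp ((φ : ℂ) * I)) ^ k i / ((r : ℂ) * cexp ((φ : ℂ) * I)) ^ a) := by
    intro φ
    have hpt : ∀ ψ : ℝ,
        (∑ i ∈ s, c i * (((r : ℂ) * cexp ((φ : ℂ) * I)) ^ k i * ((r : ℂ) * cexp ((ψ : ℂ) * I)) ^ l i)) /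
          (((r : ℂ) * cexp ((φ : ℂ) * I)) ^ a * ((r : ℂ) * cexp ((ψ : ℂ) * I)) ^ b) =
        ∑ i ∈ s, (c i * (((r : ℂ) * cexp ((φ : ℂ) * I)) ^ k i / ((r : ℂ) * cexp ((φ : ℂ) * I)) ^ a)) *
          (((r : ℂ) * cexp ((ψ : ℂ) * I)) ^ l i / ((r : ℂ) * cexp ((ψ : ℂ) * I)) ^ b) := by
      intro ψ
      rw [Finset.sum_div]
      refine Finset.sum_congr rfl fun i _ => ?_
      rw [mul_div_assoc, mul_div_mul_comm, mul_assoc]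
    simp_rw [hpt]
    have hint : ∀ i ∈ s, IntervalIntegrable
        (fun ψ : ℝ => (c i * (((r : ℂ) * cexp ((φ : ℂ) * I)) ^ k i / ((r : ℂ) * cexp ((φ : ℂ) * I)) ^ a)) *
          (((r : ℂ) * cexp ((ψ : ℂ) * I)) ^ l i / ((r : ℂ) * cexp ((ψ : ℂ) * I)) ^ b)) volume 0 (2 * Real.pi) :=
      fun i _ => (continuous_const.mul (continuous_circlePoint_pow_div hr (l i) b)).intervalIntegrable _ _
    rw [intervalIntegral.integral_finsetSum hint]
    refine Finset.sum_congr rfl fun i _ => ?_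
    rw [intervalIntegral.integral_const_mul, integral_circlePoint_pow_div hr]
    ring
  simp_rw [hinner]
  have hint' : ∀ i ∈ s, IntervalIntegrable
      (fun φ : ℝ => (c i * (if l i = b then (2 * Real.pi : ℂ) else 0)) *
        (((r : ℂ) * cexp ((φ : ℂ) * I)) ^ k i / ((r : ℂ) * cexp ((φ : ℂ) * I)) ^ a)) volume 0 (2 * Real.pi) :=
    fun i _ => (continuous_const.mul (continuous_circlePoint_pow_div hr (k i) a)).intervalIntegrable _ _
  rw [intervalIntegral.integral_finsetSum hint']
  simp_rw [intervalIntegral.integral_const_mul, integral_circlePoint_pow_div hr, Finset.mul_sum]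
  refine Finset.sum_congr rfl fun i _ => ?_
  have hπ : (2 * Real.pi : ℂ) ≠ 0 := by exact_mod_cast Real.two_pi_pos.ne'
  by_cases hk : k i = a <;> by_cases hl : l i = b <;> simp [hk, hl]; field_simp

end Circle

/-! ## §2 Compression of `e^{−βH}` to a spin sector of a sector-preserving `H` -/

section Block

variable {Λ : Type*} [LinearOrder Λ] [Fintype Λ]

/-- A matrix conserving `N↑, N↓` has no entries from a sector `p` determined by `(N↑, N↓)` to its complement (also after scaling). -/
theorem smul_toBlock_compl_eq_zero_of_preservesSectors (H : Matrix (Finset (Orb Λ)) (Finset (Orb Λ)) ℂ)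
    (hH : PreservesSectors H) (p : Finset (Orb Λ) → Prop) [DecidablePred p] (a b : ℕ)
    (hp : ∀ s, p s ↔ (upPart s).card = a ∧ (downPart s).card = b) (β : ℂ) :
    (-β • H).toBlock p (fun x => ¬ p x) = 0 := by
  ext x y
  rw [toBlock_apply, Matrix.smul_apply, smul_eq_mul, Matrix.zero_apply]
  by_cases hxy : H x.1 y.1 = 0
  · rw [hxy, mul_zero]
  · exfalso
    have h := hH _ _ hxy
    have hx := (hp _).1 x.2
    exact y.2 ((hp _).2 ⟨h.1.symm.trans hx.1, h.2.symm.trans hx.2⟩)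

/-- **Sector partition function at complex temperature as an indicator-weighted diagonal sum of `e^{−βH}`**:
`tr e^{−β H_p} = Σ_{s ∈ p} (e^{−βH})_{ss}` for `H` conserving `N↑, N↓` and `p` an `(N↑, N↓)` sector. -/
theorem trace_exp_neg_smul_toBlock_eq_sum_ite {inst : DecidableEq (Finset (Orb Λ))} (H : Matrix (Finset (Orb Λ)) (Finset (Orb Λ)) ℂ)
    (hH : PreservesSectors H) (p : Finset (Orb Λ) → Prop) [DecidablePred p] (a b : ℕ)
    (hp : ∀ s, p s ↔ (upPart s).card = a ∧ (downPart s).card = b) (β : ℂ) :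
    (NormedSpace.exp (-β • H.toBlock p p)).trace = ∑ s, if p s then (NormedSpace.exp (-β • H)) s s else 0 := by
  have h1 : -β • H.toBlock p p = (-β • H).toBlock p p := rfl
  rw [h1, ← toBlock_exp_of_toBlock_compl_eq_zero _ p (smul_toBlock_compl_eq_zero_of_preservesSectors H hH p a b hp β)]
  simp only [Matrix.trace, diag_apply, toBlock_apply]
  rw [← Finset.sum_filter]
  exact (Finset.sum_subtype (Finset.univ.filter p) (by simp) fun s => (NormedSpace.exp (-β • H)) s s).symm

/-- The sector predicate of `thermalFluxLogZ` (`#s = 2m` and `2·#{spin-0 orbitals} = 2m`) is the `(m, m)` spin sector. -/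
theorem card_and_two_mul_card_filter_iff (s : Finset (Orb Λ)) (m : ℕ) :
    (s.card = 2 * m ∧ 2 * (s.filter fun i => (ofLex i).2 = 0).card = 2 * m) ↔
      ((upPart s).card = m ∧ (downPart s).card = m) := by
  rw [card_filter_spin_zero_eq_card_upPart', card_eq_upPart_add_downPart]
  omega

end Block

/-! ## §3 The projection identity -/

section Projection

variable {Λ : Type*} [LinearOrder Λ] [Fintype Λ]

/-- The two-fugacity weighted trace is a finite sum of monomials: `tr(diag(z^{N↑} w^{N↓}) X) = Σ_s X_{ss} z^{#↑s} w^{#↓s}`. -/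
theorem trace_diagonal_fugacity_mul {inst : DecidableEq (Finset (Orb Λ))} (X : Matrix (Finset (Orb Λ)) (Finset (Orb Λ)) ℂ)
    (z w : ℂ) :
    (@diagonal _ ℂ inst _ (fun s : Finset (Orb Λ) => z ^ (upPart s).card * w ^ (downPart s).card) * X).trace =
      ∑ s, X s s * (z ^ (upPart s).card * w ^ (downPart s).card) := by
  simp only [Matrix.trace, diag_apply, diagonal_mul]
  exact Finset.sum_congr rfl fun s _ => mul_comm _ _

/-- **The fugacity-torus projection identity (Darwin–Fowler at complex `β`).** For `H` conserving `N↑, N↓` and the sector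
`p = {#↑ = a, #↓ = b}`: `tr e^{−βH_p} = (2π)⁻² ∬ tr(diag(ζ↑^{N↑}ζ↓^{N↓}) e^{−βH}) ζ↑^{−a} ζ↓^{−b} dψ dφ` on `|ζ↑| = |ζ↓| = r > 0`,
for every complex `β`. -/
theorem trace_exp_neg_smul_toBlock_eq_torusIntegral {inst : DecidableEq (Finset (Orb Λ))}
    (H : Matrix (Finset (Orb Λ)) (Finset (Orb Λ)) ℂ)
    (hH : PreservesSectors H) (p : Finset (Orb Λ) → Prop) [DecidablePred p] (a b : ℕ)
    (hp : ∀ s, p s ↔ (upPart s).card = a ∧ (downPart s).card = b) (β : ℂ) {r : ℝ} (hr : 0 < r) :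
    (NormedSpace.exp (-β • H.toBlock p p)).trace =
      ((2 * Real.pi : ℂ) ^ 2)⁻¹ * ∫ φ in (0 : ℝ)..2 * Real.pi, ∫ ψ in (0 : ℝ)..2 * Real.pi,
        (@diagonal _ ℂ inst _ (fun s : Finset (Orb Λ) =>
            ((r : ℂ) * cexp ((φ : ℂ) * I)) ^ (upPart s).card * ((r : ℂ) * cexp ((ψ : ℂ) * I)) ^ (downPart s).card) *
          NormedSpace.exp (-β • H)).trace /
          (((r : ℂ) * cexp ((φ : ℂ) * I)) ^ a * ((r : ℂ) * cexp ((ψ : ℂ) * I)) ^ b) := by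
  rw [trace_exp_neg_smul_toBlock_eq_sum_ite H hH p a b hp β]
  simp_rw [trace_diagonal_fugacity_mul]
  rw [torusIntegral_finset_sum]
  · refine Finset.sum_congr rfl fun s _ => ?_
    simp only [hp s]
  · exact hr

end Projection

/-! ## §4 The seam-flux `t–t′` Hubbard torus -/

section Torus

variable (L : ℕ) [NeZero L]

/-- **K1 of the crux idea `fugacity-torus-saddle` (stub `stub_fugacityProjection` with the line's definitions unfolded).**
The complex-temperature partition function of the twisted `t–t′` Hubbard torus in the sector `#s = 2m ∧ 2·#{spin 0} = 2m` is the
`(m, m)` coefficient of the two-fugacity twisted grand-canonical trace on any circles of radius `r > 0`. -/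
theorem hubbardTorusTT'Flux_sector_trace_exp_eq_torusIntegral (tp U θ : ℝ) (β : ℂ) {r : ℝ} (hr : 0 < r) (m : ℕ) :
    (NormedSpace.exp (-β • (hubbardTorusTT'Flux L tp U θ).toBlock
        (fun s => s.card = 2 * m ∧ 2 * (s.filter fun i => (ofLex i).2 = 0).card = 2 * m)
        (fun s => s.card = 2 * m ∧ 2 * (s.filter fun i => (ofLex i).2 = 0).card = 2 * m))).trace =
      ((2 * Real.pi : ℂ) ^ 2)⁻¹ * ∫ φ in (0 : ℝ)..2 * Real.pi, ∫ ψ in (0 : ℝ)..2 * Real.pi,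
        (diagonal (fun s : Finset (Orb (FermionTorus 2 L)) =>
            ((r : ℂ) * cexp ((φ : ℂ) * I)) ^ (upPart s).card * ((r : ℂ) * cexp ((ψ : ℂ) * I)) ^ (downPart s).card) *
          NormedSpace.exp (-β • hubbardTorusTT'Flux L tp U θ)).trace /
          (((r : ℂ) * cexp ((φ : ℂ) * I)) ^ m * ((r : ℂ) * cexp ((ψ : ℂ) * I)) ^ m) :=
  trace_exp_neg_smul_toBlock_eq_torusIntegral _ (preservesSectors_hubbardTorusTT'Flux L tp U θ) _ m m
    (fun s => card_and_two_mul_card_filter_iff s m) β hr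

end Torus

end Summit.Ventures.CertifiedManyBodySolver.Theorems.TcThermcert1.ZeroFreeCorridor
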